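import Literature.NumberTheory.EllipticCurves.TateUniformisation
import Literature.NumberTheory.EllipticCurves.TateCurve.NumberField
import Literature.NumberTheory.EllipticCurves.TateCurve.TateParameter
import Literature.NumberTheory.DiophantineGeometry.LocalReductionProofs
import Mathlib.FieldTheory.Galois.Infinite
import Mathlib.FieldTheory.IsSepClosed
import HarnessLib

/-!
# Full `n`-torsion (`n ≥ 3`) rational over `K_v` forces SPLIT multiplicative reduction at `v`
# (Silverman ATAEC V.5.3 + Cor. V.5.4; consumer: [IUTchI] Ex. 3.2 (iv), residual `hsplit`)

Topic `Literature/NumberTheory/EllipticCurves/TateCurve`, namespace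
`Literature.NumberTheory.EllipticCurves.TateCurve` (abc-iut cell, WAVE-5 seat abc-iut-w5-d219; support for
the DAG node IUTchI:Ex3.2(iv)). PROOF-ONLY: theorems, no definitions, no new named facts.

S. Mochizuki, *Inter-universal Teichmüller theory I*, kurims manuscript (May 2020), Example 3.2 (iv) p. 71,
reads the `q`-parameter `q_v ∈ K_v̲` of `E_F` at `v̲ ∈ 𝕍^bad` through the Tate uniformisation, i.e. uses that
`E_K := E_F ×_F K` has SPLIT multiplicative reduction at the places of `K = F(E_F[l])` over `𝕍^bad_mod`, while
Def. 3.1 (b) only records (bad) MULTIPLICATIVE reduction of `E_F` over `F_mod`. The tree's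
`InitialThetaData.exists_pow_two_mul_l_eq_tateParameter` (abc-iut-w5-d209) therefore carries the hypothesis
`hsplit : (E.baseChange K).HasSplitMultiplicativeReductionAt w`. This file supplies the classical fact behind it:

* `no_twist_of_card_torsion` — PURE ALGEBRA. Let `Ψ : K̄_v^× → M` be a homomorphism into an abelian group whose
  kernel lies in `q^ℤ` (`q ∈ K_v`, not a root of unity: `q^a = q^b ⇒ a = b`) and which kills `q`, and let
  `σ₀ ∈ Aut(K̄_v/K_v)`. If `n ≥ 3` and `n²` distinct `n`-torsion elements of `M` are of the form `Ψ(u)` with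
  `u·σ₀(u) ∈ q^ℤ`, contradiction: `uⁿ = q^k` and `(u σ₀ u)ⁿ = q^{2k} = q^{mn}` give `n ∣ 2k`; the class
  `k mod n` has fibres of size `≤ #μ_n(K̄_v) ≤ n`, so `n²` points exhaust `ℤ/n`, some `k ≡ 1`, and `n ∣ 2`.
* `isSquare_gamma_of_card_torsion_of_corV54` — with Silverman's twisted Tate uniformisation (the tree's NAMED FACT
  `Literature.NumberTheory.EllipticCurves.Silverman1994_thmV53_corV54_tateUniformisation`, ATAEC V.5.3 with
  Lemma V.5.2 (c) / Cor. V.5.4, whose clause (4) says that every `K_v`-rational point is `Ψ(u)` with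
  `u·σ(u) ∈ q^ℤ` for every `σ` moving `t = √γ`): if `E(K_v)` has `n²` points killed by `n ≥ 3` then no `σ`
  moves `t`, so `t ∈ K_v` (Galois theory of `K̄_v/K_v`) and `γ(E/K_v) = −c₄/c₆` is a square in `K_v`.
* `hasSplitMultiplicativeReductionAt_of_card_torsion_of_corV54` — hence, by the tree's PROVED ATAEC V.5.3 (b)
  (`splitMultiplicative_tfae_holds`: `γ` square ⇒ some `K_v`-model is minimal with split multiplicative
  reduction) and the PROVED independence of the minimal model
  (`WeierstrassCurve.hasSplitMultiplicativeReduction_iff_of_isMinimal_of_eq_smul`), the chosen local minimal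
  model has split multiplicative reduction: `W.HasSplitMultiplicativeReductionAt v`.

The theorems of the second and third items are CONDITIONAL on the named fact (taken as a hypothesis `h54`,
D-0014); the BSD/abc-iut seat abc-iut-w5-d205 is discharging it (`…_holds`), after which the conclusions are
unconditional. Classical (Silverman); nothing here bears on [IUTchIII] Cor. 3.12.

## References
* [SilvermanATAEC1994] J. H. Silverman, *Advanced Topics in the Arithmetic of Elliptic Curves*, GTM 151,
  Springer 1994, Lemma V.5.2, Thm. V.5.3, Cor. V.5.4 (held copy PDF pp. 406–410).
* [Mochizuki2012] S. Mochizuki, *Inter-universal Teichmüller theory I*, Def. 3.1 (b)(c) pp. 61–62, Example 3.2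
  (iv) p. 71 (consumer only).
-/

noncomputable section

open scoped Classical

namespace Literature.NumberTheory.EllipticCurves.TateCurve

open WeierstrassCurve

/-! ### §1. Pure algebra: `n²` twisted-rational `n`-torsion points force `n ∣ 2` -/

section Algebra

variable {F : Type*} [Field F] {L : Type*} [Field L] [Algebra F L] {M : Type*} [AddCommGroup M]

/-- **No nontrivial twist with full `n`-torsion, `n ≥ 3`.** `Ψ : L^× → M` a homomorphism whose kernel lies
in `q^ℤ` and contains `q` (`q ∈ F`, `q^a = q^b ⇒ a = b`), `σ₀` an `F`-automorphism of `L`, `S` a set of at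
least `n²` elements of `M` killed by `n`, each of the form `Ψ(u)` with `u · σ₀(u) ∈ q^ℤ`: impossible for
`n ≥ 3`. (Silverman ATAEC Cor. V.5.4: the `K`-points of the non-split twist are `{u : N(u) ∈ q^ℤ}`; their
`n`-torsion has at most `n · #{k mod n : n ∣ 2k}`... elements.) [cite: SilvermanATAEC1994, Cor. V.5.4 (PDF pp. 409–410)] -/
theorem no_twist_of_card_torsion (Ψ : Additive Lˣ →+ M) (q : F)
    (hq0 : algebraMap F L q ≠ 0)
    (hqinj : ∀ a b : ℤ, (algebraMap F L q) ^ a = (algebraMap F L q) ^ b → a = b)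
    (hker : ∀ u : Lˣ, Ψ (Additive.ofMul u) = 0 → ∃ k : ℤ, (u : L) = (algebraMap F L q) ^ k)
    (hΨq : Ψ (Additive.ofMul (Units.mk0 (algebraMap F L q) hq0)) = 0)
    (σ₀ : L ≃ₐ[F] L) {n : ℕ} (hn : 3 ≤ n) (S : Finset M) (hS : ∀ P ∈ S, n • P = 0)
    (hcard : n ^ 2 ≤ S.card)
    (hwit : ∀ P ∈ S, ∃ u : Lˣ, (∃ m : ℤ, ((u * Units.map (σ₀ : L →* L) u : Lˣ) : L) =
      (algebraMap F L q) ^ m) ∧ Ψ (Additive.ofMul u) = P) : False := by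
  set Q : L := algebraMap F L q with hQdef
  have hn0 : 0 < n := by omega
  haveI : NeZero n := ⟨hn0.ne'⟩
  -- choose, for every `P ∈ S`, a witness `u_P`, the exponent `m_P` of `u·σ₀u`, and `k_P` of `u^n`
  choose u hu using hwit
  have hm : ∀ P (hP : P ∈ S), ∃ m : ℤ, ((u P hP * Units.map (σ₀ : L →* L) (u P hP) : Lˣ) : L) = Q ^ m :=
    fun P hP => (hu P hP).1
  have hΨu : ∀ P (hP : P ∈ S), Ψ (Additive.ofMul (u P hP)) = P := fun P hP => (hu P hP).2
  have hk : ∀ P (hP : P ∈ S), ∃ k : ℤ, ((u P hP ^ n : Lˣ) : L) = Q ^ k := by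
    intro P hP
    apply hker
    rw [ofMul_pow, map_nsmul, hΨu P hP, hS P hP]
  choose m hm' using hm
  choose k hk' using hk
  -- `σ₀` fixes `Q`
  have hσQ : σ₀ Q = Q := σ₀.commutes q
  have hQ0 : Q ≠ 0 := hq0
  -- (a) `n ∣ 2 k_P`
  have hdvd : ∀ P (hP : P ∈ S), (n : ℤ) ∣ 2 * k P hP := by
    intro P hP
    have h1 : ((u P hP : L) * σ₀ (u P hP : L)) ^ n = Q ^ (2 * k P hP) := by
      have hu_n : (u P hP : L) ^ n = Q ^ k P hP := by
        have := hk' P hP; simpa [Units.val_pow_eq_pow_val] using this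
      have hσu_n : (σ₀ (u P hP : L)) ^ n = Q ^ k P hP := by
        rw [← map_pow, hu_n, map_zpow₀, hσQ]
      rw [mul_pow, hu_n, hσu_n, ← zpow_add₀ hQ0, two_mul]
    have h2 : ((u P hP : L) * σ₀ (u P hP : L)) ^ n = Q ^ (m P hP * n) := by
      have := hm' P hP
      have h3 : ((u P hP * Units.map (σ₀ : L →* L) (u P hP) : Lˣ) : L) = (u P hP : L) * σ₀ (u P hP : L) := by
        simp [Units.val_mul]
      rw [← h3, this, ← zpow_natCast, ← zpow_mul]
    have h12 : 2 * k P hP = m P hP * n := hqinj _ _ (h1.symm.trans h2)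
    exact ⟨m P hP, by rw [h12, mul_comm]⟩
  -- (b) the class `k_P mod n`; fibres are translates of `Ψ(μ_n)`
  let f : M → ZMod n := fun P => if hP : P ∈ S then ((k P hP : ℤ) : ZMod n) else 0
  have hfib : ∀ P (hP : P ∈ S) (P' : M) (hP' : P' ∈ S), f P = f P' →
      ∃ w : Lˣ, w ∈ rootsOfUnity n L ∧ P = P' + Ψ (Additive.ofMul w) := by
    intro P hP P' hP' hff
    have hff' : ((k P hP : ℤ) : ZMod n) = ((k P' hP' : ℤ) : ZMod n) := by
      simpa [f, hP, hP'] using hff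
    obtain ⟨j, hj⟩ : ∃ j : ℤ, k P hP = k P' hP' + n * j := by
      have := (ZMod.intCast_eq_intCast_iff_dvd_sub _ _ _).mp hff'.symm
      obtain ⟨j, hj⟩ := this
      exact ⟨j, by linarith⟩
    set qu : Lˣ := Units.mk0 Q hQ0 with hqu
    refine ⟨u P hP * (u P' hP')⁻¹ * qu ^ (-j), ?_, ?_⟩
    · rw [mem_rootsOfUnity]
      apply Units.ext
      have e1 : ((u P hP : L)) ^ n = Q ^ k P hP := by
        have := hk' P hP; simpa [Units.val_pow_eq_pow_val] using this
      have e2 : ((u P' hP' : L)) ^ n = Q ^ k P' hP' := by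
        have := hk' P' hP'; simpa [Units.val_pow_eq_pow_val] using this
      have e3 : ((qu ^ (-j) : Lˣ) : L) = Q ^ (-j) := by
        rw [Units.val_zpow_eq_zpow_val, hqu, Units.val_mk0]
      rw [Units.val_pow_eq_pow_val, Units.val_mul, Units.val_mul, Units.val_inv_eq_inv_val, e3,
        mul_pow, mul_pow, e1, inv_pow, e2, ← zpow_natCast (Q ^ (-j)) n, ← zpow_mul, ← zpow_neg,
        ← zpow_add₀ hQ0, ← zpow_add₀ hQ0, hj, Units.val_one]
      have : k P' hP' + ↑n * j + -k P' hP' + -j * ↑n = 0 := by ring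
      rw [this, zpow_zero]
    · rw [ofMul_mul, ofMul_mul, map_add, map_add, ofMul_inv, map_neg, ofMul_zpow, map_zsmul,
        hΨu P hP, hΨu P' hP']
      have : Ψ (Additive.ofMul qu) = 0 := by rw [hqu]; exact hΨq
      rw [this, smul_zero, add_zero]
      abel
  -- every fibre of `f` on `S` has at most `n` elements
  haveI : Fintype (rootsOfUnity n L) := Fintype.ofFinite _
  have hμcard : Fintype.card (rootsOfUnity n L) ≤ n := by
    rw [← Nat.card_eq_fintype_card]; exact card_rootsOfUnity L n
  have hfibcard : ∀ b ∈ S.image f, (S.filter (fun P => f P = b)).card ≤ n := by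
    intro b hb
    obtain ⟨P', hP', rfl⟩ := Finset.mem_image.mp hb
    have hsub : S.filter (fun P => f P = f P') ⊆
        (Finset.univ : Finset (rootsOfUnity n L)).image
          (fun w : rootsOfUnity n L => P' + Ψ (Additive.ofMul (w.1 : Lˣ))) := by
      intro P hP
      rw [Finset.mem_filter] at hP
      obtain ⟨w, hw, hPw⟩ := hfib P hP.1 P' hP' hP.2
      refine Finset.mem_image.mpr ⟨⟨w, hw⟩, Finset.mem_univ _, ?_⟩
      exact hPw.symm
    calc (S.filter (fun P => f P = f P')).card
        ≤ ((Finset.univ : Finset (rootsOfUnity n L)).image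
            (fun w : rootsOfUnity n L => P' + Ψ (Additive.ofMul (w.1 : Lˣ)))).card :=
          Finset.card_le_card hsub
      _ ≤ (Finset.univ : Finset (rootsOfUnity n L)).card := Finset.card_image_le
      _ = Fintype.card (rootsOfUnity n L) := Finset.card_univ
      _ ≤ n := hμcard
  -- hence the image of `f` is all of `ZMod n`
  have himg : n ≤ (S.image f).card := by
    have h := Finset.card_le_mul_card_image S n hfibcard
    have : n ^ 2 ≤ n * (S.image f).card := hcard.trans h
    rw [sq] at this
    exact Nat.le_of_mul_le_mul_left this hn0
  have huniv : S.image f = Finset.univ := by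
    apply Finset.eq_univ_of_card
    apply le_antisymm (Finset.card_le_univ _)
    simpa [ZMod.card] using himg
  -- some `P` has `k_P ≡ 1 (mod n)`, contradicting `n ∣ 2 k_P` and `n ≥ 3`
  have h1 : (1 : ZMod n) ∈ S.image f := by rw [huniv]; exact Finset.mem_univ _
  obtain ⟨P, hP, hfP⟩ := Finset.mem_image.mp h1
  have hkP : ((k P hP : ℤ) : ZMod n) = 1 := by simpa [f, hP] using hfP
  have hdvd1 : (n : ℤ) ∣ k P hP - 1 := by
    have : ((k P hP - 1 : ℤ) : ZMod n) = 0 := by push_cast; rw [hkP, sub_self]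
    exact (ZMod.intCast_zmod_eq_zero_iff_dvd _ _).mp this
  have h2 : (n : ℤ) ∣ 2 := by
    have := hdvd P hP
    have h' : (2 : ℤ) = 2 * k P hP - 2 * (k P hP - 1) := by ring
    rw [h']
    exact dvd_sub this (dvd_mul_of_dvd_right hdvd1 2)
  have : (n : ℤ) ≤ 2 := Int.le_of_dvd (by norm_num) h2
  omega

end Algebra


/-! ### §2–§4. The twisted Tate uniformisation ⇒ `γ` is a square ⇒ split multiplicative reduction -/

section NumberField

open NumberField IsDedekindDomain Field SteinWuthrich2013

variable {K : Type} [Field K] [NumberField K]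

/-- Base-changed `K_v`-points of `W` are fixed by `Γ_{K_v}` inside `E(K̄_v) = localPoints W K_v`.
[cite: SilvermanATAEC1994, Thm. V.3.1 (d) (PDF p. 395)] -/
theorem smul_pointMap_eq (W : WeierstrassCurve K) (v : HeightOneSpectrum (𝓞 K))
    (σ : absoluteGaloisGroup (v.adicCompletion K))
    (P : (W.baseChange (v.adicCompletion K)).toAffine.Point) :
    σ • (show localPoints W (v.adicCompletion K) from
        WeierstrassCurve.Affine.Point.map
          (IsScalarTower.toAlgHom K (v.adicCompletion K) (AlgebraicClosure (v.adicCompletion K))) P) =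
      (show localPoints W (v.adicCompletion K) from
        WeierstrassCurve.Affine.Point.map
          (IsScalarTower.toAlgHom K (v.adicCompletion K) (AlgebraicClosure (v.adicCompletion K))) P) := by
  rw [localPoints.smul_def]
  change WeierstrassCurve.Affine.Point.map _ (WeierstrassCurve.Affine.Point.map _ P) = _
  rw [WeierstrassCurve.Affine.Point.map_map]
  have hcomp : ((AlgEquiv.restrictScalars K
        (show AlgebraicClosure (v.adicCompletion K) ≃ₐ[v.adicCompletion K]
          AlgebraicClosure (v.adicCompletion K) from σ) :
          AlgebraicClosure (v.adicCompletion K) ≃ₐ[K] AlgebraicClosure (v.adicCompletion K)) :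
        AlgebraicClosure (v.adicCompletion K) →ₐ[K] AlgebraicClosure (v.adicCompletion K)).comp
      (IsScalarTower.toAlgHom K (v.adicCompletion K) (AlgebraicClosure (v.adicCompletion K))) =
      IsScalarTower.toAlgHom K (v.adicCompletion K) (AlgebraicClosure (v.adicCompletion K)) := by
    apply AlgHom.ext
    intro x
    exact AlgEquiv.commutes
      (show AlgebraicClosure (v.adicCompletion K) ≃ₐ[v.adicCompletion K]
        AlgebraicClosure (v.adicCompletion K) from σ) x
  rw [hcomp]

/-- **`n²` rational `n`-torsion points, `n ≥ 3`, force `γ(E/K_v) = −c₄/c₆` to be a square in `K_v`**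
(conditional on the named fact `Silverman1994_thmV53_corV54_tateUniformisation`, Silverman ATAEC V.5.3 with
Lemma V.5.2 (c) / Cor. V.5.4): clause (4) of the fact writes every `K_v`-point as `Ψ(u)` with `u·σ(u) ∈ q^ℤ`
for each `σ` moving `t = √γ`; by `no_twist_of_card_torsion` no `σ ∈ Γ_{K_v}` moves `t`, so `t ∈ K_v`.
[cite: SilvermanATAEC1994, Thm. V.5.3 and Cor. V.5.4 (PDF pp. 407–410)] -/
theorem isSquare_gamma_of_card_torsion_of_corV54
    (h54 : Silverman1994_thmV53_corV54_tateUniformisation.{0})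
    (W : WeierstrassCurve K) [W.IsElliptic] (v : HeightOneSpectrum (𝓞 K))
    (hmult : W.HasMultiplicativeReductionAt v) {n : ℕ} (hn : 3 ≤ n)
    (S : Finset (W.baseChange (v.adicCompletion K)).toAffine.Point) (hS : ∀ P ∈ S, n • P = 0)
    (hcard : n ^ 2 ≤ S.card) :
    IsSquare (algebraMap K (v.adicCompletion K) (-(W.c₄ / W.c₆))) := by
  letI := Literature.NumberTheory.GaloisRepresentations.Ultrametric.AdicCompletion.nontriviallyNormedField K v
  haveI := charZero_adicCompletion' K v
  obtain ⟨q, t, Ψ, hq0, hqv, ht0, ht2, -, hker, -, hfix⟩ := h54 W v hmult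
  -- abbreviations
  let ι := algebraMap (v.adicCompletion K) (AlgebraicClosure (v.adicCompletion K))
  have hιq0 : ι q ≠ 0 := (map_ne_zero ι).mpr hq0
  -- `q` is not a root of unity: `q^a = q^b ⇒ a = b` (`0 < ‖q‖ < 1`)
  have hqinj : ∀ a b : ℤ, ι q ^ a = ι q ^ b → a = b := by
    intro a b hab
    have hab' : q ^ a = q ^ b := by
      apply ι.injective
      rw [map_zpow₀, map_zpow₀, hab]
    have hqn : ‖q‖ < 1 := Valued.toNormedField.norm_lt_one_iff.mpr hqv
    have hq0' : 0 < ‖q‖ := norm_pos_iff.mpr hq0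
    have := congrArg (fun x : v.adicCompletion K => ‖x‖) hab'
    simp only [norm_zpow] at this
    exact zpow_right_injective₀ hq0' hqn.ne this
  have hker' : ∀ u : (AlgebraicClosure (v.adicCompletion K))ˣ, Ψ (Additive.ofMul u) = 0 →
      ∃ k : ℤ, (u : AlgebraicClosure (v.adicCompletion K)) = ι q ^ k := fun u hu => (hker u).mp hu
  have hΨq : Ψ (Additive.ofMul (Units.mk0 (ι q) hιq0)) = 0 :=
    (hker _).mpr ⟨1, by rw [zpow_one, Units.val_mk0]⟩
  -- Step 1: no `σ` moves `t`
  have hfixt : ∀ σ : absoluteGaloisGroup (v.adicCompletion K),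
      absoluteGaloisGroup.toAlgEquiv (v.adicCompletion K) σ t = t := by
    by_contra hcon
    simp only [not_forall] at hcon
    obtain ⟨σ₀, hσ₀⟩ := hcon
    let ιpt : (W.baseChange (v.adicCompletion K)).toAffine.Point →+ localPoints W (v.adicCompletion K) :=
      WeierstrassCurve.Affine.Point.map
        (IsScalarTower.toAlgHom K (v.adicCompletion K) (AlgebraicClosure (v.adicCompletion K)))
    have hinj : Function.Injective ιpt := WeierstrassCurve.Affine.Point.map_injective _
    let S' : Finset (localPoints W (v.adicCompletion K)) := S.map ⟨ιpt, hinj⟩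
    have hS' : ∀ P ∈ S', n • P = 0 := by
      intro P hP
      obtain ⟨P₀, hP₀, rfl⟩ := Finset.mem_map.mp hP
      change n • ιpt P₀ = 0
      rw [← map_nsmul, hS P₀ hP₀, map_zero]
    have hcard' : n ^ 2 ≤ S'.card := by rwa [Finset.card_map]
    refine no_twist_of_card_torsion Ψ q hιq0 hqinj hker' hΨq
      (absoluteGaloisGroup.toAlgEquiv (v.adicCompletion K) σ₀) hn S' hS' hcard' ?_
    intro P hP
    obtain ⟨P₀, hP₀, rfl⟩ := Finset.mem_map.mp hP
    have hPfix : ∀ σ : absoluteGaloisGroup (v.adicCompletion K),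
        σ • (ιpt P₀ : localPoints W (v.adicCompletion K)) = ιpt P₀ :=
      fun σ => smul_pointMap_eq W v σ P₀
    obtain ⟨u, -, hu2, hu3⟩ := hfix (ιpt P₀) hPfix
    exact ⟨u, hu2 σ₀ hσ₀, hu3⟩
  -- Step 2: `t ∈ K_v`
  have hall : ∀ f : AlgebraicClosure (v.adicCompletion K) ≃ₐ[v.adicCompletion K]
      AlgebraicClosure (v.adicCompletion K), f t = t := by
    intro f
    have := hfixt ((absoluteGaloisGroup.toAlgEquiv (v.adicCompletion K)).symm f)
    simpa using this
  have ht : t ∈ (⊥ : IntermediateField (v.adicCompletion K) (AlgebraicClosure (v.adicCompletion K))) :=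
    (InfiniteGalois.mem_bot_iff_fixed t).mpr hall
  obtain ⟨t₀, ht₀⟩ := IntermediateField.mem_bot.mp ht
  -- Step 3: `γ = t₀²`
  refine ⟨t₀, ?_⟩
  apply ι.injective
  rw [map_mul, ← sq]
  change ι _ = (algebraMap (v.adicCompletion K) (AlgebraicClosure (v.adicCompletion K)) t₀) ^ 2
  rw [ht₀, ht2]

/-- **Full `n`-torsion (`n ≥ 3`) rational over `K_v` at a place of multiplicative reduction forces SPLIT
multiplicative reduction** (conditional on the named fact `Silverman1994_thmV53_corV54_tateUniformisation`):
`γ(E/K_v)` is a square (`isSquare_gamma_of_card_torsion_of_corV54`), hence by the tree's PROVED Silverman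
ATAEC V.5.3 (b) (`splitMultiplicative_tfae_holds`, (ii) ⇒ (iii)) some `K_v`-model is a minimal equation
with split multiplicative reduction, hence (independence of the minimal model,
`WeierstrassCurve.hasSplitMultiplicativeReduction_iff_of_isMinimal_of_eq_smul`) so is the chosen local minimal
model: `W.HasSplitMultiplicativeReductionAt v`. The `|j| > 1` input is AEC VII.5.1 (b)
(`one_lt_norm_j_of_hasMultiplicativeReduction_holds`). Consumer: the residual `hsplit` of
`InitialThetaData.exists_pow_two_mul_l_eq_tateParameter` ([IUTchI] Ex. 3.2 (iv), with `n := l`).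
[cite: SilvermanATAEC1994, Thm. V.5.3 (b) (PDF pp. 407–409)] -/
theorem hasSplitMultiplicativeReductionAt_of_card_torsion_of_corV54
    (h54 : Silverman1994_thmV53_corV54_tateUniformisation.{0})
    (W : WeierstrassCurve K) [W.IsElliptic] (v : HeightOneSpectrum (𝓞 K))
    (hmult : W.HasMultiplicativeReductionAt v) {n : ℕ} (hn : 3 ≤ n)
    (S : Finset (W.baseChange (v.adicCompletion K)).toAffine.Point) (hS : ∀ P ∈ S, n • P = 0)
    (hcard : n ^ 2 ≤ S.card) : W.HasSplitMultiplicativeReductionAt v := by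
  letI := Literature.NumberTheory.GaloisRepresentations.Ultrametric.AdicCompletion.nontriviallyNormedField K v
  haveI := charZero_adicCompletion' K v
  have hsq := isSquare_gamma_of_card_torsion_of_corV54 h54 W v hmult hn S hS hcard
  set E : WeierstrassCurve (v.adicCompletion K) := W.baseChange (v.adicCompletion K) with hE
  haveI : E.IsElliptic := inferInstanceAs (W.map (algebraMap K (v.adicCompletion K))).IsElliptic
  have hγE : -(E.c₄ / E.c₆) = algebraMap K (v.adicCompletion K) (-(W.c₄ / W.c₆)) := by
    simp only [hE, WeierstrassCurve.baseChange, WeierstrassCurve.map_c₄, WeierstrassCurve.map_c₆,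
      map_neg, map_div₀]
  have hsqE : IsSquare (-(E.c₄ / E.c₆)) := hγE ▸ hsq
  -- the chosen local minimal model and `|j| > 1`
  set D : WeierstrassCurve.VariableChange (v.adicCompletion K) :=
    (E.exists_isMinimal (v.adicCompletionIntegers K)).choose with hD
  have hX : W.localMinimalModel v = D • E := rfl
  have hm : (W.localMinimalModel v).HasMultiplicativeReduction (v.adicCompletionIntegers K) := hmult
  haveI : (W.localMinimalModel v).IsElliptic := W.isElliptic_localMinimalModel v
  have hj1 : 1 < ‖(W.localMinimalModel v).j‖ :=
    one_lt_norm_j_of_hasMultiplicativeReduction_holds (v.adicCompletionIntegers K)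
      (norm_le_one_iff_mem_range_adicCompletionIntegers K v) _ hm
  have hjeq : (W.localMinimalModel v).j = E.j := WeierstrassCurve.variableChange_j (C := D) (W := E)
  have hjE : 1 < ‖E.j‖ := hjeq ▸ hj1
  -- ATAEC V.5.3 (b): (ii) ⇒ (iii)
  have htfae := splitMultiplicative_tfae_holds (v.adicCompletionIntegers K)
    (norm_le_one_iff_mem_range_adicCompletionIntegers K v) E (tateParameter E hjE) hjE
    (tateParameter_ne_zero E hjE) (norm_tateParameter_lt_one E hjE) (tateJ_tateParameter E hjE)
  obtain ⟨C, hC⟩ := (htfae.out 1 2).mp hsqE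
  -- transfer to the chosen local minimal model
  haveI : WeierstrassCurve.IsMinimal (v.adicCompletionIntegers K) (C • E) :=
    hC.toHasMultiplicativeReduction.toIsMinimal
  have hrel : W.localMinimalModel v = (D * C⁻¹) • (C • E) := by
    rw [hX, smul_smul, inv_mul_cancel_right]
  have hΔ : (C • E).Δ ≠ 0 := (C • E).isUnit_Δ.ne_zero
  exact (WeierstrassCurve.hasSplitMultiplicativeReduction_iff_of_isMinimal_of_eq_smul
    (v.adicCompletionIntegers K) hrel hΔ).mpr hC

end NumberField

end Literature.NumberTheory.EllipticCurves.TateCurve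

end
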